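import Summits.QuantumFields.BalabanUV.T4Continuum.Support.B13DomainGeometry
import Summits.QuantumFields.BalabanUV.T4Continuum.Support.B13DomainGeometryTR

/-!
# NE5 ∕ U3, route P2 — THE END OF THE ACTIVITY ROUTE ON BAŁABAN's CARRIERS OF RECORD: the two domain geometries RECONCILED
# (`B13DomainGeometryTR.domainGeometry R = B13DomainGeometry.domainGeometry R`), the leaves L03 ∕ L08 over the geometry of record,
# and route P2's END `∃ C₅, NE5 …` over `B13Carriers.TwoRuns.carriers` with the polymer-geometry side PROVED

Cell `pub-balaban`, unit `b2b-balaban-t4-ne5-p2-g17` (T⁴ fan-out NE5 ∕ node U3, PROVER seat P2 = co-owner #2 of the NE5 row, technique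
«polymer-activity Lipschitz route via Kotecký–Preiss»; skeleton `t4/skeletons/NE5-t4-ne5-p2.md`, rows O1′ R-rep ∕ R-KP ∕ END).  Summits-side
bookkeeping over the O1-a INSTANCE OF RECORD `Support/B13Carriers.lean` (`TwoRuns`, p207668, adopted journal l.5870).  HONEST FRAMING: rung
(B)+1 of the FINITE-VOLUME T⁴ continuum programme — NOT infinite volume, NOT a mass gap, NOT the Clay problem, NOT a proof of NE5; spine
0∕9.  HONEST DEPENDENCY (cell line, verbatim): continuum YM on T⁴ ⇐ BetaPertH ∧ nine spine estimates (0/9 proved); BetaPertH ⇐ (D1) ∧ (D4)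
∧ CAP+tail; G-an2-4 gates asym, D1 and NE2/3/4.

WHY THIS FILE.  Two adapters of route P2's `ClusterRepOfDomains.DomainGeometry` to Bałaban's paired torus domains reached the tree within
minutes of each other: the supplier's `B13DomainGeometryTR` (p208152: geometry + the transported (1.26) ∕ (2.27) ∕ (2.30) ∕ locality +
the LEAVES `decayExtract_b13` ∕ `pinBudget_b13` ∕ `kpInflated_b13`) and the O1-a holder lineage's `B13DomainGeometry` (p208264: geometry +
the five hypotheses `p2_geometry_hypotheses`).  A fork of the carrier geometry would split every downstream row, so §1 proves the two
geometries are EQUAL (same sigma cubes, same footprints and reaches DEFINITIONALLY, touching relations equivalent — mine by a transported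
`TAdj`, theirs by a Σ-equation), and §2–§3 state everything route P2 supplies OVER THE GEOMETRY OF RECORD `B13DomainGeometry.domainGeometry R`
(the holder lineage's), so downstream seats import one name.

WHAT IS PROVED (0 sorry):
* §1 `footprint_eq_foot`, `reach_eq_reach` (both `rfl`), `sAdj_iff_cAdj`, `touch_iff_touch`, **`domainGeometry_eq`**, `clusterRep_eq`.
* §2 over the geometry of record: **`decayExtract_rec`** (L08a, `DecayExtract (σ(d+5)) (σd+5σ)`, any σ ≥ 0), **`pinBudget_rec`** (L08b,
  `PinBudget (τ·#foot) (σ(d+5)) (64τ·e^{−5σ}) κ` for κ + 1 ≤ σ), **`kpInflated_rec`** (L03 from ONLY the (2.38)-SHAPED majorant `m ≤ A e^{−R d}`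
  on every 𝐃_k — hypothesis SHAPE, locator [Balaban1988RG2Cluster] Lemma 3 (2.38) p. 20, asserted nowhere — and the two explicit inequalities
  `64·log 162 + σ + 64τ ≤ R`, `(1+s)·A·e^{5σ+64τ}·K₀(64,8)·9 ≤ τ`).
* §3 **`ne5_above_max_rec`**: route P2's END `∃ C₅, NE5 EA EB W κ θ′ C₅` (θ′ above `max θ r_fb`, `r_fb = ω + 64τe^{−5σ}·Λhist·cg∕(s − Λhist·ρ₀′)`)
  for functionals on `R.carriers` represented by the cluster representation of the geometry of record, in which the FIVE polymer-geometry
  hypotheses of `ClusterRepDecay.ne5_above_max_of_domainGeometry_linear` (`hloc`, `hreach`, `h126`, `hvol`, `h227`) and the constants'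
  signs are DISCHARGED (ν = 9, κ₀ = 64·log 162, K₀ = K₀(64,8), c₁ = 64, c = 5 — theorems of `TreeLengthTorusGeometry.tgeometry 4 N`);
  what it still displays, by name and in letters, is exactly the analytic side: the term model and its well-formedness (NODE O rows
  O1-b∕c∕d∕e), the per-term majorant domination `hsum` (R-KP in letters, (2.38)), MI-R (`ReadsStep`, `Reads`, `ReadsB`), W1 = `OperatorRate`
  (rows NE2 ∕ NE3), the insertion-data rates `BaseRate` ∕ `VecRate` and the `AgeBudget` (NE2-type ∕ one-run inputs), the decay bounds of
  the two functionals, and the numerical side conditions (O6-n).  NOTHING of that list is asserted here.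
-/

open scoped BigOperators

namespace Summit.QuantumFields.BalabanUV.T4Continuum.B13ActivityRouteEnd

open Literature.MathematicalPhysics.QuantumFieldTheory.Balaban1983to89
open Literature.MathematicalPhysics.QuantumFieldTheory.Balaban1983to89.T4OutputRate (Carriers Functional DecayBound NE5)
open Literature.MathematicalPhysics.QuantumFieldTheory.Balaban1983to89.TreeLengthTorus (TPt TAdj TDom)
open Literature.MathematicalPhysics.QuantumFieldTheory.Balaban1983to89.T4ActivityRecursion (KPInflated)
open Literature.MathematicalPhysics.QuantumFieldTheory.Balaban1983to89.T4InputCauchyRateData (StepModel)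
open Summit.QuantumFields.BalabanUV.T4Continuum.B13Carriers (TwoRuns)
open Summit.QuantumFields.BalabanUV.T4Continuum.ClusterRepOfDomains (DomainGeometry)
open Summit.QuantumFields.BalabanUV.T4Continuum.ClusterRepKP (kpInflated_of_majorant)
open Summit.QuantumFields.BalabanUV.T4Continuum.ClusterRepDecay (decayExtract_of_ineq227 pinBudget_of_volBound
  ne5_above_max_of_domainGeometry_linear)
open Summit.QuantumFields.BalabanUV.T4Continuum.InsertionLinearClass (LinearInsertion)
open Summit.QuantumFields.BalabanUV.T4Continuum.InsertionLinearRate.LinearPair (ReadsB BaseRate VecRate)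
open Summit.QuantumFields.BalabanUV.T4Continuum.ActivityTermModel (TermFamily)
open Summit.QuantumFields.BalabanUV.T4Continuum.ActivityStepJunction (ReadsStep)

variable {G : Type} [GaugeGroup G] {R : TwoRuns G}

/-! ## §1 The two adapters define ONE geometry -/

/-- [folklore] The supplier's footprint IS the holder lineage's `foot` (definitionally: both are the scale-tagged cubes). -/
theorem footprint_eq_foot (X : R.carriers.Dom) : B13DomainGeometryTR.footprint X = B13DomainGeometry.foot X := rfl

/-- [folklore] The supplier's reach IS the holder lineage's `reach` (definitionally: the tagged torus reach). -/
theorem reach_eq_reach (Z : R.carriers.Dom) : B13DomainGeometryTR.reach Z = B13DomainGeometry.reach Z := rfl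

/-- [folklore] The two taggings of wall adjacency agree: a transported `TAdj` (supplier) iff a Σ-equation with `TAdj` (holder lineage). -/
theorem sAdj_iff_cAdj (a b : B13DomainGeometryTR.SCube R) : B13DomainGeometryTR.SAdj R a b ↔ B13DomainGeometry.CAdj R a b := by
  obtain ⟨j, x⟩ := a
  obtain ⟨j', y⟩ := b
  constructor
  · intro h
    have hjj : j = j' := B13DomainGeometryTR.fst_eq_of_sAdj h
    subst hjj
    exact (B13DomainGeometry.cAdj_mk_iff x y).2 (B13DomainGeometryTR.sAdj_mk_iff.1 h)
  · intro h
    have hjj : j = j' := B13DomainGeometry.CAdj.fst_eq h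
    subst hjj
    exact B13DomainGeometryTR.sAdj_mk_iff.2 ((B13DomainGeometry.cAdj_mk_iff x y).1 h)

/-- [folklore] The two touching relations ((2.11) p. 14) agree. [cite: Balaban1988RG2Cluster, (2.11) p.14] -/
theorem touch_iff_touch (A B : Finset (B13DomainGeometryTR.SCube R)) :
    B13DomainGeometryTR.touch (R := R) A B ↔ B13DomainGeometry.touch R A B := by
  unfold B13DomainGeometryTR.touch B13DomainGeometry.touch
  exact exists_congr fun a => and_congr_right fun _ => exists_congr fun b => and_congr_right fun _ =>
    or_congr Iff.rfl (sAdj_iff_cAdj (R := R) a b)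

/-- [folklore] The two touching relations are equal as relations. -/
theorem touch_eq_touch : @B13DomainGeometryTR.touch G _ R = B13DomainGeometry.touch R :=
  funext fun A => funext fun B => propext (touch_iff_touch A B)

/-- [folklore] **ONE GEOMETRY**: the supplier's `B13DomainGeometryTR.domainGeometry R` (p208152) EQUALS the holder lineage's geometry of
record `B13DomainGeometry.domainGeometry R` (p208264) — footprints and catalogues definitionally, touching by `touch_eq_touch`, the
decidability instance by subsingleton-ness. -/
theorem domainGeometry_eq (R : TwoRuns G) : B13DomainGeometryTR.domainGeometry R = B13DomainGeometry.domainGeometry R := by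
  have ht : @B13DomainGeometryTR.touch G _ R = B13DomainGeometry.touch R := touch_eq_touch
  unfold B13DomainGeometryTR.domainGeometry B13DomainGeometry.domainGeometry
  congr 1

/-- [folklore] Hence ONE cluster representation of route P2 on Bałaban's carriers. -/
theorem clusterRep_eq (R : TwoRuns G) (ρA ρB : (ℕ → ℝ) → R.carriers.BgB → R.carriers.Dom → ℂ) :
    B13DomainGeometryTR.clusterRep R ρA ρB = (B13DomainGeometry.domainGeometry R).clusterRep ρA ρB := by
  rw [B13DomainGeometryTR.clusterRep, domainGeometry_eq]

/-! ## §2 The leaves L03 ∕ L08 over the geometry OF RECORD -/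

/-- [folklore] (2.30) for the geometry of record with the constant written `64` (the holder lineage prints `4·2⁴`). [cite: Balaban1988RG2Cluster, (2.30) p.18] -/
theorem volBound_rec (k : ℕ) :
    B13FamilySum.VolBound ((B13DomainGeometry.domainGeometry R).level k) (B13DomainGeometry.domainGeometry R).cubes R.carriers.d 64 :=
  B13DomainGeometryTR.volBound_level k

/-- [folklore] (1.26) for the geometry of record with `κ₀ = 64·log 162`, `K₀ = K₀(64, 8)`. [cite: Balaban1987RG1, (1.26) p.257] -/
theorem ineq126_rec (k : ℕ) :
    B13FamilySum.Ineq126 ((B13DomainGeometry.domainGeometry R).level k) (B13DomainGeometry.domainGeometry R).cubes R.carriers.d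
      (64 * Real.log 162) (B12TreeDecay.K₀ (4 * 2 ^ 4) (2 * 4)) :=
  B13DomainGeometryTR.ineq126_level k

/-- [folklore] **L08a OVER THE GEOMETRY OF RECORD**: decay extraction `DecayExtract (σ·(d + 5)) (σ·d + σ·5)` for route P2's cluster
representation on Bałaban's carriers, from (2.27) (printed constant 5) as a THEOREM of the torus geometry; any `σ ≥ 0`.
[cite: Balaban1988RG2Cluster, (2.27) p.18] -/
theorem decayExtract_rec (ρA ρB : (ℕ → ℝ) → R.carriers.BgB → R.carriers.Dom → ℂ) {σ : ℝ} (hσ : 0 ≤ σ) :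
    ((B13DomainGeometry.domainGeometry R).clusterRep ρA ρB).DecayExtract (fun X => σ * (R.carriers.d X + 5))
      (fun Z => σ * R.carriers.d Z + σ * 5) :=
  decayExtract_of_ineq227 (B13DomainGeometry.domainGeometry R) ρA ρB hσ fun X => B13DomainGeometry.ineq227_dom X

/-- [folklore] **L08b OVER THE GEOMETRY OF RECORD**: the pin budget `PinBudget (τ·#foot) (σ·(d + 5)) (τ·64·e^{−5σ}) κ` for `κ + 1 ≤ σ`,
from (2.30) as a THEOREM of the torus geometry. [cite: Balaban1988RG2Cluster, (2.30) p.18] -/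
theorem pinBudget_rec (ρA ρB : (ℕ → ℝ) → R.carriers.BgB → R.carriers.Dom → ℂ) {τ σ κ : ℝ} (hτ : 0 ≤ τ) (hσκ : κ + 1 ≤ σ) :
    ((B13DomainGeometry.domainGeometry R).clusterRep ρA ρB).PinBudget (fun Z => τ * ((B13DomainGeometry.foot Z).card : ℝ))
      (fun X => σ * (R.carriers.d X + 5)) (τ * 64 * Real.exp (-(σ * 5))) κ :=
  pinBudget_of_volBound (B13DomainGeometry.domainGeometry R) ρA ρB (c := 5) hτ (by norm_num) hσκ volBound_rec

/-- [folklore] **L03 OVER THE GEOMETRY OF RECORD, MODULO THE (2.38)-SHAPED MAJORANT AND TWO NUMBERS**: `KPInflated` for route P2's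
cluster representation on Bałaban's carriers from a nonnegative majorant `m ≤ A·e^{−R·d}` on every 𝐃_k (hypothesis SHAPE, locator
Lemma 3 (2.38) p. 20 — asserted nowhere), the rate room `64·log 162 + σ + 64τ ≤ R` and the smallness
`(1 + s)·A·e^{5σ+64τ}·K₀(64,8)·9 ≤ τ`; (1.26), (2.30), footprint locality and the reach count ν = 9 are THEOREMS (holder lineage's `loc`,
`reach_le`; the torus (1.26) ∕ (2.30)). [cite: Balaban1988RG2Cluster, Lemma 3 (2.38) p.20] -/
theorem kpInflated_rec (ρA ρB : (ℕ → ℝ) → R.carriers.BgB → R.carriers.Dom → ℂ) {W : Set (ℕ → ℝ)}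
    {m : (ℕ → ℝ) → R.carriers.BgB → R.carriers.Dom → ℝ} {A Rm τ σ s : ℝ}
    (hA : 0 ≤ A) (hτ : 0 ≤ τ) (hσ : 0 ≤ σ) (hs : 0 ≤ s)
    (hm0 : ∀ g U Z, 0 ≤ m g U Z)
    (hm : ∀ g ∈ W, ∀ U (k : ℕ), ∀ Z ∈ R.domAt k, m g U Z ≤ A * Real.exp (-(Rm * R.carriers.d Z)))
    (hrate : 64 * Real.log 162 + σ + τ * 64 ≤ Rm)
    (hsmall : (1 + s) * A * Real.exp (σ * 5 + τ * 64) * B12TreeDecay.K₀ (4 * 2 ^ 4) (2 * 4) * 9 ≤ τ) :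
    KPInflated ((B13DomainGeometry.domainGeometry R).clusterRep ρA ρB) W m s
      (fun Z => τ * ((B13DomainGeometry.foot Z).card : ℝ)) (fun Z => σ * R.carriers.d Z + σ * 5) :=
  kpInflated_of_majorant (B13DomainGeometry.domainGeometry R) ρA ρB B13DomainGeometry.reach R.carriers.d
    B13DomainGeometry.loc B13DomainGeometry.reach_le R.carriers.d_nonneg hA (B12TreeDecay.K₀_pos _ _).le hτ hσ
    (mul_nonneg hσ (by norm_num)) hs hm0 hm ineq126_rec volBound_rec hrate hsmall

/-! ## §3 Route P2's END over Bałaban's carriers of record — polymer geometry PROVED, analysis displayed -/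

section End

variable {Op Hist : Type*} [NormedAddCommGroup Op] [NormedSpace ℂ Op] [NormedAddCommGroup Hist] [NormedSpace ℂ Hist]
variable {ι κι S Ω Ω₀ 𝒴 𝒞 : Type*} [Fintype ι] [Fintype κι] [MeasurableSpace Ω] [MeasurableSpace Ω₀] {J : Type*}
  [DecidableEq ι] [DecidableEq κι] [DecidableEq 𝒞]

/-- [folklore] **ROUTE P2's END ON BAŁABAN's CARRIERS OF RECORD.**  For output functionals `EA`, `EB` on `R.carriers` (R : `TwoRuns G`, the
O1-a instance of record) represented by route P2's cluster representation over the geometry of record, `∃ C₅, NE5 EA EB W κ θ′ C₅` for every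
`θ′ > max θ (ω + 64τe^{−5σ}·Λhist∕(s − Λhist·ρ₀′)·cg)` — `ClusterRepDecay.ne5_above_max_of_domainGeometry_linear` with its five
polymer-geometry hypotheses and the constants' signs DISCHARGED by theorems of the torus geometry (ν = 9, κ₀ = 64·log 162, K₀ = K₀(64,8),
c₁ = 64, c = 5).  DISPLAYED, asserted nowhere: the term family `𝔉` over the representation with `WellFormed` and the per-term majorant
domination `hsum` by a (2.38)-shaped `m` (NODE O rows O1-b∕c∕d∕e, R-KP in letters), MI-R (`ReadsStep`, `LA.Reads`, `ReadsB`), the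
representation ∕ realization ∕ base hypotheses, the decay bounds of `EA` ∕ `EB`, W1 = `OperatorRate` (rows NE2 ∕ NE3), `BaseRate` ∕ `VecRate` ∕
`AgeBudget`, and the numerical side conditions (O6-n).  NOT a proof of NE5. [cite: Balaban1988RG2Cluster, Lemma 3 (2.38) p.20] -/
theorem ne5_above_max_rec (R : TwoRuns G) (ρA ρB : (ℕ → ℝ) → R.carriers.BgB → R.carriers.Dom → ℂ)
    (𝔉 : TermFamily ((B13DomainGeometry.domainGeometry R).clusterRep ρA ρB) Op Hist ι κι S Ω Ω₀ 𝒴 𝒞 J)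
    {N : StepModel R.carriers Op Hist} (hN : ReadsStep 𝔉.model N)
    {EA : Functional R.carriers R.carriers.BgA} {EB : Functional R.carriers R.carriers.BgB} {W : Set (ℕ → ℝ)}
    {LA LB : LinearInsertion R.carriers Hist} (hLA : LA.Reads N W) (hLB : ReadsB LB N W) (hdom : ∀ k, LA.dom k = LB.dom k)
    {m : (ℕ → ℝ) → R.carriers.BgB → R.carriers.Dom → ℝ}
    {A_m R_m τ σ s A₀ E₀ E₁ κ θ δ δb δv cg ω Λop Λhist ρ₀ ρ₀' : ℝ}
    -- R-KP in letters: the (2.38)-shaped majorant and the two explicit inequalities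
    (hA_m : 0 ≤ A_m) (hτ : 0 ≤ τ) (hσ : 0 ≤ σ) (hs0 : 0 ≤ s)
    (hm0 : ∀ (g : ℕ → ℝ) (U : R.carriers.BgB) (Z : R.carriers.Dom), 0 ≤ m g U Z)
    (hm : ∀ g ∈ W, ∀ (U : R.carriers.BgB) (k : ℕ), ∀ Z ∈ R.domAt k, m g U Z ≤ A_m * Real.exp (-(R_m * R.carriers.d Z)))
    (hrate : 64 * Real.log 162 + σ + τ * 64 ≤ R_m)
    (hsmall : (1 + s) * A_m * Real.exp (σ * 5 + τ * 64) * B12TreeDecay.K₀ (4 * 2 ^ 4) (2 * 4) * 9 ≤ τ) (hσκ : κ + 1 ≤ σ)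
    -- the term model, the per-term majorant domination, the representation, the levels
    (hwf : 𝔉.WellFormed W)
    (hsum : ∀ g ∈ W, ∀ (U : R.carriers.BgB) (X : R.carriers.Dom), ∀ γ ∈ ((B13DomainGeometry.domainGeometry R).clusterRep ρA ρB).vol X,
      ∑ i ∈ 𝔉.terms g U X γ, 𝔉.G Λop Λhist ρ₀ g U X γ i ≤ m g U γ)
    (hρ01 : ρ₀ ≤ 1)
    (hrep : ((B13DomainGeometry.domainGeometry R).clusterRep ρA ρB).Represents EA EB) (hreal : 𝔉.model.Realizes EA EB W)
    (hbase : 𝔉.model.InBase EB W)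
    (hdA : DecayBound EA W A₀ κ) (hdB : DecayBound EB W E₀ κ)
    -- W1, the insertion-data rates, the age budget, numerics
    (hop : N.OperatorRate W δ θ)
    (hbr : BaseRate LA LB N W δb θ) (hvr : VecRate LA LB N W κ δv θ) (hbudget : LA.AgeBudget N W κ cg ω)
    (hE₀ : 0 ≤ E₀) (hδb : 0 ≤ δb) (hδv : 0 ≤ δv)
    (hE₁ : 0 < E₁) (hΛop : 0 < Λop) (hΛhist : 0 < Λhist) (hρ : max (Λhist / Λop) 1 * ρ₀' ≤ ρ₀)
    (hs : Λhist * ρ₀' < s) (hδ : 0 ≤ δ) (hθ : 0 ≤ θ) (hθ1 : θ < 1)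
    (hcg : 0 ≤ cg) (hω : 0 < ω) (hω1 : ω < 1) (hreachH : cg * (A₀ + E₀) / (1 - ω) < ρ₀')
    {θ' : ℝ} (hθ' : max θ (ω + (τ * 64 * Real.exp (-(σ * 5))) * Λhist / (s - Λhist * ρ₀') * cg) < θ') :
    ∃ C₅, NE5 EA EB W κ θ' C₅ :=
  ne5_above_max_of_domainGeometry_linear (B13DomainGeometry.domainGeometry R) ρA ρB 𝔉 hN hLA hLB hdom B13DomainGeometry.reach
    (κ₀ := 64 * Real.log 162) (K₀ := B12TreeDecay.K₀ (4 * 2 ^ 4) (2 * 4)) (c₁ := 64) (c := 5) (ν := 9) (E₁ := E₁)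
    B13DomainGeometry.loc B13DomainGeometry.reach_le hA_m (B12TreeDecay.K₀_pos _ _).le hτ hσ (by norm_num) (by norm_num) hs0 hm0 hm
    ineq126_rec volBound_rec (fun X => B13DomainGeometry.ineq227_dom X) hrate hsmall hσκ hwf hsum hρ01 hrep hreal hbase hdA hdB hop
    hbr hvr hbudget hE₀ hδb hδv hE₁ hΛop hΛhist hρ hs hδ hθ hθ1 hcg hω hω1 hreachH hθ'

end End

end Summit.QuantumFields.BalabanUV.T4Continuum.B13ActivityRouteEnd
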